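import Summits.CriticalPhenomena.PercolationContinuityZ3.Theorems.PercNearOneGluingNoHeavyQuantCondTwoPointSigma
import Mathlib.Tactic.Linarith
import HarnessLib

/-!
# `Z(3,2)` (`OneCutFive.ZeroOneThree`) follows from the SYMMETRIC PRODUCT ROW of the three-target pocket law:
# `x_a · x_b · x_c ≤ x_{ab} · x_{bc} · x_{ca}` under `Σ q > 2`

builds on p205010 (kernel theorem, internal audit signed; external expert review pending)

Support file (prover seat `prim-quant-p1` (gen 38), QUANT lane R8, front "FAR beyond trees", layer one at `|A| = 3`;
`--supports stmt-CriticalPhenomena-4575 --as helper`).  No definitions, no named facts, no sorries; standard axioms.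
Memo: `run/shared/lean/prim/quant/prim-quant-p1-g38/FOR-LEAD-Z32-PRODUCT.md`.

Notation: observer `o`, targets `a, b, c` (all distinct), `q_v = μ(o ↔ v)`, pocket `B = C_o ∩ {a,b,c}`, cells
`x_S = μ(B = S)`.  `Z(3,2)` ⟺ [`Σ_v q_v > 2` ⟹ `∃ v, x_v ≤ x_{R∖v}`].  THE ROW (conjectured here, "PocketTriple"):

  (PT)  `o, a, b, c` distinct, `q_a + q_b + q_c > 2`  ⟹  `x_a · x_b · x_c ≤ x_{ab} · x_{bc} · x_{ca}`.

It is SYMMETRIC (no argmin), MULTIPLICATIVE (`⟺ Π_v odds(o ↔ u | o ↔ v, o ↮ w) ≥ 1` around the cycle), and implies `Z(3,2)` at once: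
if every singleton cell exceeded its complementary pair cell the two products would compare the other way.  This file records the
implication (`zeroOneThree_of_pocketTriple`), through the weakest-vertex exchange `pocketExchange_of_pocketTriple` and the tree's
`zeroOneThree_of_pocketExchange`; the row is an explicit hypothesis in the binders (no `@[conjecture]` definition introduced here).

EVIDENCE for (PT) (this seat; exact-DP pocket laws, scripts `num/z32_p3*.py`, `z32_climb*.py`): 0 violations on ALL graph classes
on `≤ 6` vertices × 4–6 weight palettes (19 893 regime instances, minimum of `x_{ab}x_{bc}x_{ca}/(x_a x_b x_c)` = 2.27) and under
hard-constraint adversarial climbs on `K₅, K₆` (infimum 2.0, approached); the THRESHOLD IS EXACTLY 2: violators exist with `Σ q`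
arbitrarily close to 2 from below (hub family `o –π– h, h – a, h – c`: ratio `= x_{abc}/x_∅ = πab/(1−π)`), and at `Σ q = 2` the
infimum of the ratio is 2 (`= x_{abc}/x_∅ ≥ 2` from the mean).  Nearby rows: the hypothesis-free "even ≥ odd" row
`x_∅ x_{ab} x_{bc} x_{ca} ≥ x_a x_b x_c x_{abc}` (zero three-way log-interaction = equality; holds for stars and Markov/hub laws) is
FALSE in sparse regimes (ratio unbounded) and slightly false in the dense regime (factor 0.85 at `x_{abc}/x_∅ ≈ 2`), so (PT) is not a
cheap corollary; (PT) with the hypothesis `x_{abc} ≥ x_∅` in place of `Σ q > 2` is census-clean too (tight on every zero-interaction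
law).  By van den Berg–Häggström–Kahn conditional association (tree: `BHK2006_clusterConditionalPositiveAssociation_holds`)
`x_a x_b ≤ x_∅ x_{ab}` (given `o ↮ c`), so (PT) is automatic when `x_a x_b x_c ≥ x_∅³`; the open core is the thin-singleton (glued) regime.
[cite: KozmaNitzan2024, Lemma 2 (p. 6) (level 1; the level-2 rows are this programme's)]
-/

noncomputable section

namespace Summit.CriticalPhenomena.PercolationContinuityZ3.Theorems

open MeasureTheory Set Literature.Probability.LatticeModels Literature.Probability.Percolation
open scoped Classical BigOperators

namespace OneCutFive

variable {n : ℕ}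

/-- Three strict inequalities between non-negative reals multiply. [folklore] -/
theorem prod_three_lt {a₁ a₂ a₃ b₁ b₂ b₃ : ℝ} (hb₁ : 0 ≤ b₁) (hb₂ : 0 ≤ b₂) (hb₃ : 0 ≤ b₃)
    (h₁ : b₁ < a₁) (h₂ : b₂ < a₂) (h₃ : b₃ < a₃) : b₁ * b₂ * b₃ < a₁ * a₂ * a₃ := by
  have h12 : b₁ * b₂ ≤ a₁ * a₂ := mul_le_mul h₁.le h₂.le hb₂ (hb₁.trans h₁.le)
  have ha12 : 0 < a₁ * a₂ := mul_pos (hb₁.trans_lt h₁) (hb₂.trans_lt h₂)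
  calc b₁ * b₂ * b₃ ≤ a₁ * a₂ * b₃ := mul_le_mul_of_nonneg_right h12 hb₃
    _ < a₁ * a₂ * a₃ := mul_lt_mul_of_pos_left h₃ ha12

/-- **The product row (PT) ⟹ the pocket exchange at the weakest vertex.**  If (PT) holds (hypothesis `hT`), then for distinct
`o, a, b, c` with `q_a ≤ q_b`, `q_a ≤ q_c` and `q_a + q_b + q_c > 2`: `μ(B = {a}) ≤ μ(B = {b,c})`.  (If not, the two order
relations `q_a ≤ q_b`, `q_a ≤ q_c` — in cells `x_a + x_{ac} ≤ x_b + x_{bc}`, `x_a + x_{ab} ≤ x_c + x_{bc}` — force `x_{ac} < x_b` and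
`x_{ab} < x_c`, and the three strict inequalities multiply against (PT).) [this work] -/
theorem pocketExchange_of_pocketTriple
    (hT : ∀ (n : ℕ) (w : Sym2 (Fin n) → unitInterval) (o a b c : Fin n),
      o ≠ a → o ≠ b → o ≠ c → a ≠ b → a ≠ c → b ≠ c →
      2 < (prodBernoulli w).real (openConn o a) + (prodBernoulli w).real (openConn o b) +
        (prodBernoulli w).real (openConn o c) →
      (prodBernoulli w).real {ω : BondConfig (Fin n) | ω ∈ openConn o a ∧ ω ∉ openConn o b ∧ ω ∉ openConn o c} *
          (prodBernoulli w).real {ω : BondConfig (Fin n) | ω ∉ openConn o a ∧ ω ∈ openConn o b ∧ ω ∉ openConn o c} *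
          (prodBernoulli w).real {ω : BondConfig (Fin n) | ω ∉ openConn o a ∧ ω ∉ openConn o b ∧ ω ∈ openConn o c} ≤
        (prodBernoulli w).real {ω : BondConfig (Fin n) | ω ∈ openConn o a ∧ ω ∈ openConn o b ∧ ω ∉ openConn o c} *
          (prodBernoulli w).real {ω : BondConfig (Fin n) | ω ∉ openConn o a ∧ ω ∈ openConn o b ∧ ω ∈ openConn o c} *
          (prodBernoulli w).real {ω : BondConfig (Fin n) | ω ∈ openConn o a ∧ ω ∉ openConn o b ∧ ω ∈ openConn o c})
    (w : Sym2 (Fin n) → unitInterval) (o a b c : Fin n)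
    (hoa : o ≠ a) (hob : o ≠ b) (hoc : o ≠ c) (hab : a ≠ b) (hac : a ≠ c) (hbc : b ≠ c)
    (hqab : (prodBernoulli w).real (openConn o a) ≤ (prodBernoulli w).real (openConn o b))
    (hqac : (prodBernoulli w).real (openConn o a) ≤ (prodBernoulli w).real (openConn o c))
    (hsum : 2 < (prodBernoulli w).real (openConn o a) + (prodBernoulli w).real (openConn o b) +
      (prodBernoulli w).real (openConn o c)) :
    (prodBernoulli w).real {ω : BondConfig (Fin n) | ω ∈ openConn o a ∧ ω ∉ openConn o b ∧ ω ∉ openConn o c} ≤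
      (prodBernoulli w).real {ω : BondConfig (Fin n) | ω ∉ openConn o a ∧ ω ∈ openConn o b ∧ ω ∈ openConn o c} := by
  set μ := prodBernoulli w with hμ
  set sa := μ.real {ω : BondConfig (Fin n) | ω ∈ openConn o a ∧ ω ∉ openConn o b ∧ ω ∉ openConn o c} with hsa
  set sb := μ.real {ω : BondConfig (Fin n) | ω ∉ openConn o a ∧ ω ∈ openConn o b ∧ ω ∉ openConn o c} with hsb
  set sc := μ.real {ω : BondConfig (Fin n) | ω ∉ openConn o a ∧ ω ∉ openConn o b ∧ ω ∈ openConn o c} with hsc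
  set dab := μ.real {ω : BondConfig (Fin n) | ω ∈ openConn o a ∧ ω ∈ openConn o b ∧ ω ∉ openConn o c} with hdab
  set dac := μ.real {ω : BondConfig (Fin n) | ω ∈ openConn o a ∧ ω ∉ openConn o b ∧ ω ∈ openConn o c} with hdac
  set dbc := μ.real {ω : BondConfig (Fin n) | ω ∉ openConn o a ∧ ω ∈ openConn o b ∧ ω ∈ openConn o c} with hdbc
  have h0dab : 0 ≤ dab := measureReal_nonneg
  have h0dac : 0 ≤ dac := measureReal_nonneg
  have h0dbc : 0 ≤ dbc := measureReal_nonneg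
  -- the linear relations `q_a − q_b = (sa + dac) − (sb + dbc)` and `q_a − q_c = (sa + dab) − (sc + dbc)`
  have hlin_ab : sa + dac ≤ sb + dbc := by
    have h := real_openConn_sub μ o a b
    have h1 := real_conn_notConn_split μ o a b c
    have h2 := real_conn_notConn_split μ o b a c
    have e1 : {ω : BondConfig (Fin n) | ω ∈ openConn o b ∧ ω ∉ openConn o a ∧ ω ∉ openConn o c} =
        {ω : BondConfig (Fin n) | ω ∉ openConn o a ∧ ω ∈ openConn o b ∧ ω ∉ openConn o c} := by
      ext ω; simp only [mem_setOf_eq]; tauto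
    have e2 : {ω : BondConfig (Fin n) | ω ∈ openConn o b ∧ ω ∉ openConn o a ∧ ω ∈ openConn o c} =
        {ω : BondConfig (Fin n) | ω ∉ openConn o a ∧ ω ∈ openConn o b ∧ ω ∈ openConn o c} := by
      ext ω; simp only [mem_setOf_eq]; tauto
    rw [e1, e2] at h2
    linarith
  have hlin_ac : sa + dab ≤ sc + dbc := by
    have h := real_openConn_sub μ o a c
    have h1 := real_conn_notConn_split μ o a c b
    have h2 := real_conn_notConn_split μ o c a b
    have e0 : {ω : BondConfig (Fin n) | ω ∈ openConn o a ∧ ω ∉ openConn o c ∧ ω ∉ openConn o b} =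
        {ω : BondConfig (Fin n) | ω ∈ openConn o a ∧ ω ∉ openConn o b ∧ ω ∉ openConn o c} := by
      ext ω; simp only [mem_setOf_eq]; tauto
    have e0' : {ω : BondConfig (Fin n) | ω ∈ openConn o a ∧ ω ∉ openConn o c ∧ ω ∈ openConn o b} =
        {ω : BondConfig (Fin n) | ω ∈ openConn o a ∧ ω ∈ openConn o b ∧ ω ∉ openConn o c} := by
      ext ω; simp only [mem_setOf_eq]; tauto
    have e1 : {ω : BondConfig (Fin n) | ω ∈ openConn o c ∧ ω ∉ openConn o a ∧ ω ∉ openConn o b} =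
        {ω : BondConfig (Fin n) | ω ∉ openConn o a ∧ ω ∉ openConn o b ∧ ω ∈ openConn o c} := by
      ext ω; simp only [mem_setOf_eq]; tauto
    have e2 : {ω : BondConfig (Fin n) | ω ∈ openConn o c ∧ ω ∉ openConn o a ∧ ω ∈ openConn o b} =
        {ω : BondConfig (Fin n) | ω ∉ openConn o a ∧ ω ∈ openConn o b ∧ ω ∈ openConn o c} := by
      ext ω; simp only [mem_setOf_eq]; tauto
    rw [e0, e0'] at h1
    rw [e1, e2] at h2
    linarith
  have hP := hT n w o a b c hoa hob hoc hab hac hbc hsum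
  by_contra h
  push Not at h
  -- `dbc < sa`, hence `dac < sb` and `dab < sc`; the three strict inequalities multiply against (PT)
  have h2 : dac < sb := by linarith
  have h3 : dab < sc := by linarith
  have := prod_three_lt h0dbc h0dac h0dab h h2 h3
  -- (PT) reads `sa * sb * sc ≤ dab * dbc * dac`
  nlinarith [this, hP]

/-- **(PT) ⟹ `Z(3,2)`** (`OneCutFive.ZeroOneThree`): the symmetric product row of the three-target pocket law implies the
zero-or-one row for three relays, via the tree's `zeroOneThree_of_pocketExchange`. [this work] -/
theorem zeroOneThree_of_pocketTriple
    (hT : ∀ (n : ℕ) (w : Sym2 (Fin n) → unitInterval) (o a b c : Fin n),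
      o ≠ a → o ≠ b → o ≠ c → a ≠ b → a ≠ c → b ≠ c →
      2 < (prodBernoulli w).real (openConn o a) + (prodBernoulli w).real (openConn o b) +
        (prodBernoulli w).real (openConn o c) →
      (prodBernoulli w).real {ω : BondConfig (Fin n) | ω ∈ openConn o a ∧ ω ∉ openConn o b ∧ ω ∉ openConn o c} *
          (prodBernoulli w).real {ω : BondConfig (Fin n) | ω ∉ openConn o a ∧ ω ∈ openConn o b ∧ ω ∉ openConn o c} *
          (prodBernoulli w).real {ω : BondConfig (Fin n) | ω ∉ openConn o a ∧ ω ∉ openConn o b ∧ ω ∈ openConn o c} ≤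
        (prodBernoulli w).real {ω : BondConfig (Fin n) | ω ∈ openConn o a ∧ ω ∈ openConn o b ∧ ω ∉ openConn o c} *
          (prodBernoulli w).real {ω : BondConfig (Fin n) | ω ∉ openConn o a ∧ ω ∈ openConn o b ∧ ω ∈ openConn o c} *
          (prodBernoulli w).real {ω : BondConfig (Fin n) | ω ∈ openConn o a ∧ ω ∉ openConn o b ∧ ω ∈ openConn o c}) :
    ZeroOneThree :=
  zeroOneThree_of_pocketExchange fun _ w o a b c hoa hob hoc hab hac hbc hsum hqab hqac =>
    pocketExchange_of_pocketTriple hT w o a b c hoa hob hoc hab hac hbc hqab hqac hsum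

end OneCutFive

end Summit.CriticalPhenomena.PercolationContinuityZ3.Theorems

end
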